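import Mathlib
import HarnessLib
import Summits.Ventures.LatticeQCDFlow.Scoring.ChainTimeAverage
import Summits.Ventures.LatticeQCDFlow.Scoring.FlowSamplerAutocorrelation

/-!
# The exact flow sampler's time averages have a certified error bar — UNCONDITIONAL:
# `Var[(1/N) Σ_{i<N} f(U_i)] ≤ (2e^{2δ} − 1) Var_π f / N` on `SU(n)^E`

HONEST FRAMING: exact (Metropolis-corrected) sampling algorithms for lattice gauge theory;
figures of merit are autocorrelation/cost numbers at stated couplings and volumes; no
continuum-physics claim.

Venture `LatticeQCDFlow` (cell pub-lqcd), topic `Scoring`; FANOUT row 8 (`s0-cpn-nemc`, GEN-12).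
NEW WORK of the cell, not a published result; no definition is introduced.  The composition of
`Scoring/ChainTimeAverage.lean` (the bridge from the kernel-level `autocov` to Mathlib's
`Kernel.trajMeasure` of the simulated chain: `Var[(1/N) Σ f(X_i)] ≤ (2/ε − 1) Var_π f / N` under
Doeblin by `π`) with the tree's exact flow-MCMC theorem `Exactness.flowSampler_exact_doeblin`
(row 30 / lean-2; UNCONDITIONAL via `jacobianFormula_holds`: Doeblin constant `e^{−2δ}` from a
uniform defect `δ` of Lüscher's flow equation).

## Content

* **`flowSampler_variance_timeAverage_le`** — under the hypotheses of
  `Scoring.flowSampler_autocorrelation` (smooth `S`, jointly smooth flow action with uniform defect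
  `δ` of Lüscher's equation (4.5) on `[0,1] × SU(n)^E`, `𝓕` integrating `−∂S̃_t`,
  `q = (𝓕_1)_* D[V]`): with the weight `w` of `flowSampler_exact_doeblin` (`w · q = π :=
  𝒵⁻¹e^{−S}D[U]`, `K = indepMH q w` EXACT), the Markov chain `U_0, U_1, …` with kernel `K` started in
  `π` (Mathlib's `Kernel.trajMeasure`) satisfies, for EVERY bounded measurable observable `f` and
  EVERY `N ≥ 1`: `Var[(1/N) Σ_{i<N} f(U_i)] ≤ (2 e^{2δ} − 1) · Var_π f / N`.

Reading (value-free): an approximately trivializing flow with certified defect `δ` delivers, with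
no measurement and at every volume at which `δ` holds, an honest error bar on every bounded
observable's time average — the price of exactness is the factor `2e^{2δ} − 1` over independent
sampling.  NOT CLAIMED: any value of `δ` for a concrete flow (theory-1's `TrivializingMaps/*`
quantify its volume / coupling dependence); unbounded observables; the Γ-method estimator.
-/

noncomputable section

namespace Summit.Ventures.LatticeQCDFlow.Scoring

open MeasureTheory ProbabilityTheory Filter Finset Preorder Summit.Ventures.LatticeQCDFlow.Exactness
open Literature.MathematicalPhysics.QuantumFieldTheory
open Literature.MathematicalPhysics.QuantumFieldTheory.Luscher2010
open Summit.Ventures.LatticeQCDFlow.TrivializingMaps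
open scoped ENNReal Matrix Matrix.Norms.Frobenius ContDiff

variable {d L n : ℕ} [NeZero L]

/-- **The exact flow sampler's certified error bar — UNCONDITIONAL.**  See the module docstring. -/
theorem flowSampler_variance_timeAverage_le (B : SuBasis n)
    {S : AmbConfig d L n → ℝ} (hS : ContDiff ℝ ∞ S) {F : ℝ → AmbConfig d L n → ℝ}
    (hF : ContDiff ℝ ∞ fun p : ℝ × AmbConfig d L n => F p.1 p.2)
    {Φ : ℝ → GaugeConfig d L (Matrix.specialUnitaryGroup (Fin n) ℂ) →
      GaugeConfig d L (Matrix.specialUnitaryGroup (Fin n) ℂ)}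
    (hΦ : IsFlowMap (fun t W => -linkGrad B (F t) W) Φ) {c : ℝ → ℝ} {δ : ℝ}
    (hδ : ∀ t ∈ Set.Icc (0 : ℝ) 1, ∀ U : GaugeConfig d L (Matrix.specialUnitaryGroup (Fin n) ℂ),
      |luscherL B S t (F t) (WilsonFlow.coeConfig U) - S (WilsonFlow.coeConfig U) - c t| ≤ δ)
    (q : Measure (GaugeConfig d L (Matrix.specialUnitaryGroup (Fin n) ℂ))) [IsProbabilityMeasure q]
    (hq : q = Measure.map (Φ 1) (trivialMeasure (Matrix.specialUnitaryGroup (Fin n) ℂ) d L)) :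
    ∃ w : GaugeConfig d L (Matrix.specialUnitaryGroup (Fin n) ℂ) → ℝ, ∃ hw : Measurable w,
      (q.withDensity fun U => ENNReal.ofReal (w U)) =
        boltzmannMeasure (fun U : GaugeConfig d L (Matrix.specialUnitaryGroup (Fin n) ℂ) =>
          S (WilsonFlow.coeConfig U)) ∧
      Kernel.Invariant (indepMH q w)
        (boltzmannMeasure fun U : GaugeConfig d L (Matrix.specialUnitaryGroup (Fin n) ℂ) =>
          S (WilsonFlow.coeConfig U)) ∧
      ∀ (f : GaugeConfig d L (Matrix.specialUnitaryGroup (Fin n) ℂ) → ℝ), Measurable f →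
        ∀ C : ℝ, (∀ U, |f U| ≤ C) → ∀ N : ℕ, N ≠ 0 →
        let π := boltzmannMeasure fun U : GaugeConfig d L (Matrix.specialUnitaryGroup (Fin n) ℂ) =>
          S (WilsonFlow.coeConfig U)
        haveI : Fact (Measurable w) := ⟨hw⟩
        Var[fun x : ℕ → GaugeConfig d L (Matrix.specialUnitaryGroup (Fin n) ℂ) =>
              (∑ i ∈ Finset.range N, f (x i)) / N;
            Kernel.trajMeasure (X := fun _ : ℕ => GaugeConfig d L (Matrix.specialUnitaryGroup (Fin n) ℂ))
              π (fun m : ℕ => (indepMH q w).comap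
                (fun h : (i : ↥(Finset.Iic m)) → GaugeConfig d L (Matrix.specialUnitaryGroup (Fin n) ℂ) =>
                  h ⟨m, Finset.mem_Iic.2 le_rfl⟩) (measurable_pi_apply _))]
          ≤ (2 * Real.exp (2 * δ) - 1) * autocov (indepMH q w) π (fun U => f U - ∫ V, f V ∂π) 0 / N := by
  obtain ⟨w, hw, -, -, hπ, hinv, -, hdoeb⟩ := flowSampler_exact_doeblin B hS hF hΦ hδ q hq
  haveI : Fact (Measurable w) := ⟨hw⟩
  have hS'c : Continuous fun U : GaugeConfig d L (Matrix.specialUnitaryGroup (Fin n) ℂ) =>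
      S (WilsonFlow.coeConfig U) := hS.continuous.comp WilsonFlow.continuous_coeConfig
  haveI := isProbabilityMeasure_boltzmannMeasure (d := d) (L := L) hS'c
  have hε0 : 0 < ENNReal.ofReal (Real.exp (-(2 * δ))) := ENNReal.ofReal_pos.2 (Real.exp_pos _)
  refine ⟨w, hw, hπ, hinv, fun f hf C hC N hN => ?_⟩
  have h := variance_timeAverage_le_of_doeblin (κ := indepMH q w) hinv (fun x B hB => hdoeb x hB)
    hε0 hf hC hN
  have h1 : 2 / (ENNReal.ofReal (Real.exp (-(2 * δ)))).toReal - 1 = 2 * Real.exp (2 * δ) - 1 := by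
    rw [ENNReal.toReal_ofReal (Real.exp_pos _).le, Real.exp_neg, div_inv_eq_mul]
  rw [h1] at h
  exact h

end Summit.Ventures.LatticeQCDFlow.Scoring

end
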